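import Mathlib.Analysis.SpecialFunctions.SmoothTransition
import Mathlib.Topology.MetricSpace.Basic
import HarnessLib

/-!
# Smooth windows and the junction lemma for Eliashberg's handle profile

Topic `Literature/Geometry/Symplectic`; proofs file of the fact seat of
`Literature.Geometry.Symplectic.Gompf1998_thm13_twoHandles` (**E2**, `SteinTwoHandles.lean`),
toolkit for assembling the profile of Eliashberg's handlebody (Eliashberg 1990, Lemma 3.4.3 =
Forstnerič–Kozak 2003, Prop. 3.1) from the pieces of `SteinHandleProfileStart.lean` and
`SteinHandleProfilePieces.lean`.  Forstnerič–Kozak define `f'` piecewise and smooth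
afterwards (*"We interpolate smoothly between the left and the right limit of `h''` at such a
point and integrate twice to obtain the new `h`. This does not change `h` and `h'` very much
and hence the inequality (3.1) is preserved"*); the `C^∞` variant assembled in the tree glues
the **second derivatives** of adjacent pieces by smooth windows and integrates twice, and the
preservation of the inequalities (3.2), `f (f'' + f'³/t) > 1`, `f f'/t > 1`, across a window
is the following elementary remark: (3.2) is affine in `f''`, so it holds for every value of
`f''` between the two glued pieces as soon as it holds for each of them, and the latter is an
open condition in `(f', t)` at the junction.  Contents:

* `window a ω` — the smooth step `t ↦ S((t - a(1 - ω))/(2ωa))` (Mathlib's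
  `Real.smoothTransition`): `C^∞`, values in `[0, 1]`, `= 0` for `t ≤ a(1 - ω)`, `= 1` for
  `t ≥ a(1 + ω)` (`window_zero_of_le`, `window_one_of_ge`);
* `glue_mem_uIcc`, `abs_glue_sub_le` — a convex combination `(1 - χ) x + χ y` lies between
  `x` and `y`;
* **`junction_shape_ineq`** — if at a junction `t_j > 0` with slope `p_j` both one-sided second
  derivatives `Q_a(t_j)`, `Q_b(t_j)` satisfy `m (Q + p_j³/t_j) > 1` and `m p_j/t_j > 1`
  (`m > 0` a lower bound for `f`), and `Q_a`, `Q_b` are continuous at `t_j`, then there is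
  `δ > 0` such that (3.2) holds at every `(f, f', f'', t)` with `|t - t_j| < δ`,
  `|f' - p_j| < δ`, `f ≥ m` and `f''` between `Q_a(t)` and `Q_b(t)`.

Everything is **proved**; one definition (`window`), no named fact.

## References

* F. Forstnerič, J. Kozak, *Strongly pseudoconvex handlebodies*, J. Korean Math. Soc. 40
  (2003), 727–745 (arXiv:math/0305237), Prop. 3.1 (end of proof: smoothing).
  [ForstnericKozak2003]
* Ya. Eliashberg, *Topological characterization of Stein manifolds of dimension > 2*,
  Internat. J. Math. 1 (1990), 29–46, Lemma 3.4.3. [Eliashberg1990Stein]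
-/

noncomputable section

open Set Filter Metric
open scoped Topology

namespace Literature.Geometry.Symplectic

/-! ### §1 Smooth windows -/

/-- **The smooth window** at scale `a` with relative half-width `ω`:
`window a ω t = S((t - a(1 - ω))/(2ωa))`, `S` Mathlib's `Real.smoothTransition`; it rises
from `0` (for `t ≤ a(1 - ω)`) to `1` (for `t ≥ a(1 + ω)`). [folklore] -/
def window (a ω t : ℝ) : ℝ := Real.smoothTransition ((t - a * (1 - ω)) / (2 * ω * a))

variable {a ω : ℝ}

/-- The window is `C^∞`. [folklore] -/
theorem contDiff_window {n : ℕ∞} : ContDiff ℝ n (window a ω) :=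
  Real.smoothTransition.contDiff.comp ((contDiff_id.sub contDiff_const).div_const _)

/-- `0 ≤ window ≤ 1`. [folklore] -/
theorem window_nonneg (t : ℝ) : 0 ≤ window a ω t := Real.smoothTransition.nonneg _

/-- `window ≤ 1`. [folklore] -/
theorem window_le_one (t : ℝ) : window a ω t ≤ 1 := Real.smoothTransition.le_one _

/-- `window = 0` to the left of `a(1 - ω)` (`a, ω > 0`). [folklore] -/
theorem window_zero_of_le (ha : 0 < a) (hω : 0 < ω) {t : ℝ} (ht : t ≤ a * (1 - ω)) :
    window a ω t = 0 :=
  Real.smoothTransition.zero_of_nonpos (div_nonpos_of_nonpos_of_nonneg (by linarith) (by positivity))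

/-- `window = 1` to the right of `a(1 + ω)` (`a, ω > 0`). [folklore] -/
theorem window_one_of_ge (ha : 0 < a) (hω : 0 < ω) {t : ℝ} (ht : a * (1 + ω) ≤ t) :
    window a ω t = 1 := by
  apply Real.smoothTransition.one_of_one_le
  rw [le_div_iff₀ (by positivity)]
  linarith

/-- `window = 0` eventually near every point left of `a(1 - ω)`. [folklore] -/
theorem window_eventuallyEq_zero (ha : 0 < a) (hω : 0 < ω) {t : ℝ} (ht : t < a * (1 - ω)) :
    window a ω =ᶠ[𝓝 t] fun _ => 0 := by
  filter_upwards [Iio_mem_nhds ht] with t' ht' using window_zero_of_le ha hω ht'.le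

/-- `window = 1` eventually near every point right of `a(1 + ω)`. [folklore] -/
theorem window_eventuallyEq_one (ha : 0 < a) (hω : 0 < ω) {t : ℝ} (ht : a * (1 + ω) < t) :
    window a ω =ᶠ[𝓝 t] fun _ => 1 := by
  filter_upwards [Ioi_mem_nhds ht] with t' ht' using window_one_of_ge ha hω ht'.le

/-! ### §2 Convex combinations -/

/-- A convex combination lies between its ends. [folklore] -/
theorem glue_mem_uIcc {χ x y : ℝ} (h0 : 0 ≤ χ) (h1 : χ ≤ 1) :
    (1 - χ) * x + χ * y ∈ uIcc x y := by
  rcases le_total x y with hxy | hxy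
  · rw [uIcc_of_le hxy]; constructor <;> nlinarith
  · rw [uIcc_of_ge hxy]; constructor <;> nlinarith

/-- `|(1 - χ) x + χ y - x| ≤ |y - x|`. [folklore] -/
theorem abs_glue_sub_left_le {χ x y : ℝ} (h0 : 0 ≤ χ) (h1 : χ ≤ 1) :
    |(1 - χ) * x + χ * y - x| ≤ |y - x| := by
  have : (1 - χ) * x + χ * y - x = χ * (y - x) := by ring
  rw [this, abs_mul, abs_of_nonneg h0]
  exact mul_le_of_le_one_left (abs_nonneg _) h1

/-- `|(1 - χ) x + χ y - y| ≤ |y - x|`. [folklore] -/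
theorem abs_glue_sub_right_le {χ x y : ℝ} (h0 : 0 ≤ χ) (h1 : χ ≤ 1) :
    |(1 - χ) * x + χ * y - y| ≤ |y - x| := by
  have : (1 - χ) * x + χ * y - y = -((1 - χ) * (y - x)) := by ring
  rw [this, abs_neg, abs_mul, abs_of_nonneg (by linarith)]
  exact mul_le_of_le_one_left (abs_nonneg _) (by linarith)

/-- Lower bound of a value between two others by their minimum. [folklore] -/
theorem min_le_of_mem_uIcc {q x y : ℝ} (h : q ∈ uIcc x y) : min x y ≤ q := by
  rw [mem_uIcc] at h
  rcases h with ⟨h1, -⟩ | ⟨h1, -⟩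
  · exact (min_le_left _ _).trans h1
  · exact (min_le_right _ _).trans h1

/-! ### §3 The junction lemma -/

/-- **The inequalities (3.2) across a junction.**  Let `t_j > 0`, `m > 0`, and let `Q_a`, `Q_b`
be continuous at `t_j` with `m (Q_a(t_j) + p_j³/t_j) > 1`, `m (Q_b(t_j) + p_j³/t_j) > 1`,
`m p_j/t_j > 1`.  Then there is `δ > 0` such that for all `t, p, q, f` with `|t - t_j| < δ`,
`|p - p_j| < δ`, `q` between `Q_a(t)` and `Q_b(t)`, and `f ≥ m`:
`f (q + p³/t) > 1` and `f p/t > 1`.  (The expression is affine in `q`, and for the two ends it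
is an open condition in `(p, t)`.) [cite: ForstnericKozak2003, Prop. 3.1] -/
theorem junction_shape_ineq {Qa Qb : ℝ → ℝ} {tj pj m : ℝ} (htj : 0 < tj) (hm : 0 < m)
    (hQa : ContinuousAt Qa tj) (hQb : ContinuousAt Qb tj)
    (ha : 1 < m * (Qa tj + pj ^ 3 / tj)) (hb : 1 < m * (Qb tj + pj ^ 3 / tj))
    (hII : 1 < m * pj / tj) :
    ∃ δ > 0, ∀ t p q f : ℝ, |t - tj| < δ → |p - pj| < δ → q ∈ uIcc (Qa t) (Qb t) → m ≤ f →
      1 < f * (q + p ^ 3 / t) ∧ 1 < f * p / t := by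
  -- the three open conditions, as functions of `x = (p, t)`
  have hc3 : ContinuousAt (fun x : ℝ × ℝ => x.1 ^ 3 / x.2) (pj, tj) :=
    (continuousAt_fst.pow 3).div continuousAt_snd htj.ne'
  have hca : ContinuousAt (fun x : ℝ × ℝ => m * (Qa x.2 + x.1 ^ 3 / x.2)) (pj, tj) :=
    continuousAt_const.mul ((ContinuousAt.comp (g := Qa) hQa continuousAt_snd).add hc3)
  have hcb : ContinuousAt (fun x : ℝ × ℝ => m * (Qb x.2 + x.1 ^ 3 / x.2)) (pj, tj) :=
    continuousAt_const.mul ((ContinuousAt.comp (g := Qb) hQb continuousAt_snd).add hc3)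
  have hcII : ContinuousAt (fun x : ℝ × ℝ => m * x.1 / x.2) (pj, tj) :=
    (continuousAt_const.mul continuousAt_fst).div continuousAt_snd htj.ne'
  have hev : ∀ᶠ x : ℝ × ℝ in 𝓝 (pj, tj), 1 < m * (Qa x.2 + x.1 ^ 3 / x.2) ∧
      1 < m * (Qb x.2 + x.1 ^ 3 / x.2) ∧ 1 < m * x.1 / x.2 ∧ 0 < x.2 := by
    have h4 : ∀ᶠ x : ℝ × ℝ in 𝓝 (pj, tj), 0 < x.2 := continuousAt_snd.eventually (Ioi_mem_nhds htj)
    filter_upwards [hca.eventually (Ioi_mem_nhds ha), hcb.eventually (Ioi_mem_nhds hb),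
      hcII.eventually (Ioi_mem_nhds hII), h4] with x h1 h2 h3 h4
    exact ⟨h1, h2, h3, h4⟩
  obtain ⟨δ, hδ, hball⟩ := Metric.eventually_nhds_iff.1 hev
  refine ⟨δ, hδ, fun t p q f ht hp hq hf => ?_⟩
  have hdist : dist (p, t) (pj, tj) < δ := by
    rw [Prod.dist_eq, Real.dist_eq, Real.dist_eq]
    exact max_lt hp ht
  obtain ⟨h1, h2, h3, h4⟩ := hball hdist
  simp only at h1 h2 h3 h4
  have hf0 : 0 < f := lt_of_lt_of_le hm hf
  -- affine in `q`
  have hmin : 1 < m * (min (Qa t) (Qb t) + p ^ 3 / t) := by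
    rcases le_total (Qa t) (Qb t) with h | h
    · rw [min_eq_left h]; exact h1
    · rw [min_eq_right h]; exact h2
  have hq' : min (Qa t) (Qb t) ≤ q := min_le_of_mem_uIcc hq
  have hbr : 1 < m * (q + p ^ 3 / t) :=
    lt_of_lt_of_le hmin (mul_le_mul_of_nonneg_left (by linarith) hm.le)
  have hbr0 : 0 < q + p ^ 3 / t := by
    by_contra h0
    have : m * (q + p ^ 3 / t) ≤ 0 := mul_nonpos_of_nonneg_of_nonpos hm.le (not_lt.1 h0)
    linarith
  constructor
  · calc (1 : ℝ) < m * (q + p ^ 3 / t) := hbr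
      _ ≤ f * (q + p ^ 3 / t) := mul_le_mul_of_nonneg_right hf hbr0.le
  · have hp0 : 0 < p / t := by
      by_contra h0
      have : m * p / t ≤ 0 := by
        rw [mul_div_assoc]; exact mul_nonpos_of_nonneg_of_nonpos hm.le (not_lt.1 h0)
      linarith
    calc (1 : ℝ) < m * p / t := h3
      _ = m * (p / t) := by ring
      _ ≤ f * (p / t) := mul_le_mul_of_nonneg_right hf hp0.le
      _ = f * p / t := by ring

/-- **The inequalities (3.2) in a pure region, uniformly**: if on a set of parameters the
strict inequalities hold for `(f, p, q, t)` and `f` may only increase while `q + p³/t > 0`,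
then they persist — the trivial monotonicity in `f` used together with the region lemmas.
[folklore] -/
theorem shape_ineq_mono_f {f f' p q t : ℝ} (hf : 0 < f) (hff : f ≤ f')
    (h : 1 < f * (q + p ^ 3 / t) ∧ 1 < f * p / t) :
    1 < f' * (q + p ^ 3 / t) ∧ 1 < f' * p / t := by
  obtain ⟨h1, h2⟩ := h
  have hbr : 0 < q + p ^ 3 / t := by
    by_contra h0
    have : f * (q + p ^ 3 / t) ≤ 0 := mul_nonpos_of_nonneg_of_nonpos hf.le (not_lt.1 h0)
    linarith
  have hpt : 0 < p / t := by
    by_contra h0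
    have : f * p / t ≤ 0 := by
      rw [mul_div_assoc]; exact mul_nonpos_of_nonneg_of_nonpos hf.le (not_lt.1 h0)
    linarith
  constructor
  · exact lt_of_lt_of_le h1 (mul_le_mul_of_nonneg_right hff hbr.le)
  · calc (1 : ℝ) < f * p / t := h2
      _ = f * (p / t) := by ring
      _ ≤ f' * (p / t) := mul_le_mul_of_nonneg_right hff hpt.le
      _ = f' * p / t := by ring

end Literature.Geometry.Symplectic

end
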